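import Summits.Langlands.Langlands.Theorems.ExtendedAdequacySplit
import Summits.Langlands.Langlands.Theses.ExtendedAdequacySplit

/-!
# ExtendedAdequacySplit node — PART 2: kernel, root, necessity, the child-route one-liners, and the bridges to the BORN route decls

PART 1 (`Theorems/ExtendedAdequacySplit.lean`) = §§1–2b of the lens-5 g13 node `ExtendedAdequacySplit` (CLEARED crit-1 row 229, STATUS L1131;
route-Langlands-ExtendedAdequacySplit rev 0 BORN L1140 @3f2912925bd8: XS `ExtendedAdequateLayerLifting` stmt-Langlands-26841 · CORE
`CoreIrreducibleInadequateLifting` 26842 (declared residual) · HIGH `GenericPrimeDegenerateLifting` 26843 · T_N `CoreReducibleTransport` 26844 ·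
FRAME″ `DegenerateLayerFrame` 26845 · Assembly 26846 + dedup items): group-level extended-adequacy layers, the field-level dials SXADQ / CoreIrr,
the four cells and the supports.  This PART 2 is §§3–6 of the same node VERBATIM (kernel `deg_iff_cells` = DEG ⟺ HIGH ∧ XS ∧ CRD ∧ CORE by the
position `n < ℓ` / `ℓ ≤ n` and two excluded middles; ROOT `closes` through the parent `LieDefectSplit.closes`; necessity `Cert.*`; the child-route
one-liners and their identity certificates), split only to honour the 400-line cap, plus §7 (new): `Iff.rfl` bridges stating that the BORN route
decls `Theses.ExtendedAdequacySplit.{ExtendedAdequateLayerLifting, CoreIrreducibleInadequateLifting, GenericPrimeDegenerateLifting,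
CoreReducibleTransport, DegenerateLayerFrame}` ARE the node's one-liners (kernel-checked text identity ledger ≡ node).
Nothing here proves `Langlands`.
-/

set_option linter.dupNamespace false -- project-wide option; `Summit.Langlands.Langlands` is the mandated namespace

namespace Summit.Langlands.Langlands.Theorems.CoreAdequacy.ExtAdequacy

open Filter
open scoped MatrixGroups
open Literature.NumberTheory.GaloisRepresentations
open Summit.Langlands.Langlands.Theses

/-! ## §3 KERNEL — DEG ⟺ HIGH ∧ XS ∧ CRD ∧ CORE (three excluded middles: position, SXADQ, CoreIrr; no kit; 0 EQUIV layers) -/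

/-- Position dichotomy. -/
theorem position_dichotomy (n ℓ : ℕ) : n < ℓ ∨ ℓ ≤ n := Nat.lt_or_ge n ℓ

/-- Excluded middle on SXADQ. -/
theorem sxadq_dichotomy {K : Type} [Field K] [NumberField K] {ℓ : ℕ} [Fact ℓ.Prime] {n : ℕ} (ρ : FramedGaloisRep K (PadicAlgCl ℓ) n) : SolvablyExtAdequateImage ρ ∨ ¬ SolvablyExtAdequateImage ρ := Classical.em _

/-- Excluded middle on CoreIrr. -/
theorem core_dichotomy {K : Type} [Field K] [NumberField K] {ℓ : ℕ} [Fact ℓ.Prime] {n : ℕ} (ρ : FramedGaloisRep K (PadicAlgCl ℓ) n) : CoreIrreducibleImage ρ ∨ ¬ CoreIrreducibleImage ρ := Classical.em _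

/-- The four dial regions cover every instance. -/
theorem regions_cover {K : Type} [Field K] [NumberField K] (n ℓ : ℕ) [Fact ℓ.Prime] (ρ : FramedGaloisRep K (PadicAlgCl ℓ) n) :
    n < ℓ ∨ (ℓ ≤ n ∧ SolvablyExtAdequateImage ρ) ∨ (ℓ ≤ n ∧ ¬ SolvablyExtAdequateImage ρ ∧ ¬ CoreIrreducibleImage ρ) ∨
      (ℓ ≤ n ∧ ¬ SolvablyExtAdequateImage ρ ∧ CoreIrreducibleImage ρ) := by
  rcases position_dichotomy n ℓ with h | h
  · exact Or.inl h
  rcases sxadq_dichotomy ρ with hx | hx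
  · exact Or.inr (Or.inl ⟨h, hx⟩)
  rcases core_dichotomy ρ with hc | hc
  · exact Or.inr (Or.inr (Or.inr ⟨h, hx, hc⟩))
  · exact Or.inr (Or.inr (Or.inl ⟨h, hx, hc⟩))

/-- The four dial regions are pairwise disjoint. -/
theorem regions_disjoint {K : Type} [Field K] [NumberField K] (n ℓ : ℕ) [Fact ℓ.Prime] (ρ : FramedGaloisRep K (PadicAlgCl ℓ) n) :
    ¬ (n < ℓ ∧ ℓ ≤ n) ∧
    ¬ ((ℓ ≤ n ∧ SolvablyExtAdequateImage ρ) ∧ (ℓ ≤ n ∧ ¬ SolvablyExtAdequateImage ρ ∧ ¬ CoreIrreducibleImage ρ)) ∧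
    ¬ ((ℓ ≤ n ∧ SolvablyExtAdequateImage ρ) ∧ (ℓ ≤ n ∧ ¬ SolvablyExtAdequateImage ρ ∧ CoreIrreducibleImage ρ)) ∧
    ¬ ((ℓ ≤ n ∧ ¬ SolvablyExtAdequateImage ρ ∧ ¬ CoreIrreducibleImage ρ) ∧ (ℓ ≤ n ∧ ¬ SolvablyExtAdequateImage ρ ∧ CoreIrreducibleImage ρ)) :=
  ⟨fun h => Nat.lt_irrefl n (Nat.lt_of_lt_of_le h.1 h.2), fun h => h.2.2.1 h.1.2, fun h => h.2.2.1 h.1.2, fun h => h.1.2.2 h.2.2.2⟩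

/-- DEG ⟹ each cell OUTRIGHT (each is DEG on a sub-box: WEAKER, never costume-by-strength). -/
theorem cells_of_deg (h : LieDefect.DegenerateLayerLifting) :
    GenericPrimeDegenerateLifting ∧ ExtendedAdequateLayerLifting ∧ CoreReducibleDegenerateLifting ∧ CoreIrreducibleInadequateLifting :=
  ⟨fun K _ _ n hcpt hn ih ℓ _ ι ρ hlt hc hA hS hDs hQ _ => h K n hcpt hn ih ℓ ι ρ hlt hc hA hS hDs hQ,
    fun K _ _ n hcpt hn ih ℓ _ ι ρ hlt hc hA hS hDs hQ _ _ => h K n hcpt hn ih ℓ ι ρ hlt hc hA hS hDs hQ,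
    fun K _ _ n hcpt hn ih ℓ _ ι ρ hlt hc hA hS hDs hQ _ _ _ => h K n hcpt hn ih ℓ ι ρ hlt hc hA hS hDs hQ,
    fun K _ _ n hcpt hn ih ℓ _ ι ρ hlt hc hA hS hDs hQ _ _ _ => h K n hcpt hn ih ℓ ι ρ hlt hc hA hS hDs hQ⟩

/-- HIGH ∧ XS ∧ CRD ∧ CORE ⟹ DEG (case split on position, then SXADQ, then CoreIrr). -/
theorem deg_of_cells (hH : GenericPrimeDegenerateLifting) (hX : ExtendedAdequateLayerLifting) (hB : CoreReducibleDegenerateLifting)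
    (hC : CoreIrreducibleInadequateLifting) : LieDefect.DegenerateLayerLifting := by
  intro K _ _ n hcpt hn ih ℓ _ ι ρ hlt hc hA hS hDs hQ
  rcases position_dichotomy n ℓ with hpos | hpos
  · exact hH K n hcpt hn ih ℓ ι ρ hlt hc hA hS hDs hQ hpos
  rcases sxadq_dichotomy ρ with hx | hx
  · exact hX K n hcpt hn ih ℓ ι ρ hlt hc hA hS hDs hQ hpos hx
  rcases core_dichotomy ρ with hco | hco
  · exact hC K n hcpt hn ih ℓ ι ρ hlt hc hA hS hDs hQ hpos hx hco
  · exact hB K n hcpt hn ih ℓ ι ρ hlt hc hA hS hDs hQ hpos hx hco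

/-- **THE NODE: DEG ⟺ HIGH ∧ XS ∧ CRD ∧ CORE** (outright). -/
theorem deg_iff_cells : LieDefect.DegenerateLayerLifting ↔
    GenericPrimeDegenerateLifting ∧ ExtendedAdequateLayerLifting ∧ CoreReducibleDegenerateLifting ∧ CoreIrreducibleInadequateLifting :=
  ⟨cells_of_deg, fun h => deg_of_cells h.1 h.2.1 h.2.2.1 h.2.2.2⟩

/-- The same on the TREE ROUTE decl `LieDefectSplit.DegenerateLayerLifting` (stmt-Langlands-28416), by name. -/
theorem DegenerateLayerLifting_route_iff_cells : LieDefectSplit.DegenerateLayerLifting ↔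
    GenericPrimeDegenerateLifting ∧ ExtendedAdequateLayerLifting ∧ CoreReducibleDegenerateLifting ∧ CoreIrreducibleInadequateLifting :=
  Summit.Langlands.Langlands.Theorems.LieDefectBridge.deg_route_iff.trans deg_iff_cells

/-- Cells ⟹ DEG on the TREE ROUTE decl (closing direction, by name). -/
theorem deg_route_of_cells (h : GenericPrimeDegenerateLifting ∧ ExtendedAdequateLayerLifting ∧ CoreReducibleDegenerateLifting ∧ CoreIrreducibleInadequateLifting) :
    LieDefectSplit.DegenerateLayerLifting :=
  DegenerateLayerLifting_route_iff_cells.2 h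

/-- CRD from T_N and its seven antecedents (parent / host route decls BY NAME). -/
theorem crd_of_transport (hTn : CoreReducibleTransport) (hOW : LieDefectSplit.OdlyzkoWorldAutomorphy) (hRES : LieDefectSplit.TransOdlyzkoAutomorphy) (hW : LieDefectSplit.SatakeAvatarExistence) (hDown : LieDefectSplit.CliffordSolvableDescent)
    (hPO : OdlyzkoWorldSplit.CyclotomicReducibleOrdinaryLifting) (hR2 : OdlyzkoWorldSplit.CyclotomicReducibleNonOrdinaryRankTwoLifting) (hR3 : OdlyzkoWorldSplit.CyclotomicReducibleNonOrdinaryHigherRankLifting) : CoreReducibleDegenerateLifting :=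
  hTn hOW hRES hW hDown hPO hR2 hR3

/-! ## §4 ROOT — deciding theorems concluding `_root_.Langlands` (parent route theorem `LieDefectSplit.closes` BY NAME) -/

/-- FRAME″ from the parent: the ten other binders of `LieDefectSplit.closes` give «DEG → Langlands». -/
theorem frame_of_parent (hL : LieDefectSplit.LieObstructedLifting) (hTd : LieDefectSplit.SolvableDescentTransport) (hUp : LieDefectSplit.SolvableAscentConstituent)
    (h₁ : LieDefectSplit.AdequateImageLifting) (hT : LieDefectSplit.SolvableAdequacyTransport) (hF0 : LieDefectSplit.NoAdequateLayerFrame)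
    (hOW : LieDefectSplit.OdlyzkoWorldAutomorphy) (hRES : LieDefectSplit.TransOdlyzkoAutomorphy) (hW : LieDefectSplit.SatakeAvatarExistence)
    (hDown : LieDefectSplit.CliffordSolvableDescent) : DegenerateLayerFrame :=
  fun hD => LieDefectSplit.closes hL hD hTd hOW hRES hW hUp hDown h₁ hT hF0

/-- `closes` — ROOT form: the parent's ten other tree binders (BY NAME) + the two new cruxes + HIGH + T_N + the host's R-branch: 16 binders,
conclusion `_root_.Langlands`. -/
theorem closes (hH : GenericPrimeDegenerateLifting) (hX : ExtendedAdequateLayerLifting) (hC : CoreIrreducibleInadequateLifting) (hTn : CoreReducibleTransport)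
    (hOW : LieDefectSplit.OdlyzkoWorldAutomorphy) (hRES : LieDefectSplit.TransOdlyzkoAutomorphy) (hW : LieDefectSplit.SatakeAvatarExistence) (hDown : LieDefectSplit.CliffordSolvableDescent)
    (hPO : OdlyzkoWorldSplit.CyclotomicReducibleOrdinaryLifting) (hR2 : OdlyzkoWorldSplit.CyclotomicReducibleNonOrdinaryRankTwoLifting) (hR3 : OdlyzkoWorldSplit.CyclotomicReducibleNonOrdinaryHigherRankLifting)
    (hL : LieDefectSplit.LieObstructedLifting) (hTd : LieDefectSplit.SolvableDescentTransport) (hUp : LieDefectSplit.SolvableAscentConstituent)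
    (h₁ : LieDefectSplit.AdequateImageLifting) (hT : LieDefectSplit.SolvableAdequacyTransport) (hF0 : LieDefectSplit.NoAdequateLayerFrame) : _root_.Langlands :=
  LieDefectSplit.closes hL (deg_route_of_cells ⟨hH, hX, hTn hOW hRES hW hDown hPO hR2 hR3, hC⟩) hTd hOW hRES hW hUp hDown h₁ hT hF0

/-- `closes_framed` — the CHILD ROUTE's deciding theorem: 12 binders HIGH, XS, CORE, T_N, OW, RES, W⁺, CSD, RPO, RNO₂, RNO₃, FRAME″ — all used. -/
theorem closes_framed (hH : GenericPrimeDegenerateLifting) (hX : ExtendedAdequateLayerLifting) (hC : CoreIrreducibleInadequateLifting) (hTn : CoreReducibleTransport)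
    (hOW : LieDefectSplit.OdlyzkoWorldAutomorphy) (hRES : LieDefectSplit.TransOdlyzkoAutomorphy) (hW : LieDefectSplit.SatakeAvatarExistence) (hDown : LieDefectSplit.CliffordSolvableDescent)
    (hPO : OdlyzkoWorldSplit.CyclotomicReducibleOrdinaryLifting) (hR2 : OdlyzkoWorldSplit.CyclotomicReducibleNonOrdinaryRankTwoLifting) (hR3 : OdlyzkoWorldSplit.CyclotomicReducibleNonOrdinaryHigherRankLifting)
    (hF : DegenerateLayerFrame) : _root_.Langlands :=
  hF (deg_route_of_cells ⟨hH, hX, hTn hOW hRES hW hDown hPO hR2 hR3, hC⟩)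

/-! ## §5 NECESSITY — every cell / support is implied by `_root_.Langlands` and by DEG (WEAKER, never costume-by-strength) -/

namespace Cert

/-- Langlands ⟹ DEG (landed twin certificate). -/
theorem deg_of_langlands (hS : _root_.Langlands) : LieDefect.DegenerateLayerLifting := LieDefect.Cert.deg_of_langlands hS

/-- NECESSITY: Langlands ⟹ HIGH (via DEG and the exact cut). -/
theorem high_of_langlands (hS : _root_.Langlands) : GenericPrimeDegenerateLifting := (cells_of_deg (deg_of_langlands hS)).1

/-- NECESSITY: Langlands ⟹ XS. -/
theorem xs_of_langlands (hS : _root_.Langlands) : ExtendedAdequateLayerLifting := (cells_of_deg (deg_of_langlands hS)).2.1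

/-- NECESSITY: Langlands ⟹ CRD. -/
theorem crd_of_langlands (hS : _root_.Langlands) : CoreReducibleDegenerateLifting := (cells_of_deg (deg_of_langlands hS)).2.2.1

/-- NECESSITY: Langlands ⟹ CORE (the declared residual is S-implied — WEAKER, not costume-by-strength). -/
theorem core_of_langlands (hS : _root_.Langlands) : CoreIrreducibleInadequateLifting := (cells_of_deg (deg_of_langlands hS)).2.2.2

/-- NECESSITY: Langlands ⟹ T_N (its conclusion CRD already follows). -/
theorem transport_of_langlands (hS : _root_.Langlands) : CoreReducibleTransport := fun _ _ _ _ _ _ _ => crd_of_langlands hS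

/-- NECESSITY: Langlands ⟹ FRAME″ (trivially). -/
theorem frame_of_langlands (hS : _root_.Langlands) : DegenerateLayerFrame := fun _ => hS

/-- WEAKER: DEG (the tree route decl) ⟹ HIGH. -/
theorem high_of_deg (h : LieDefectSplit.DegenerateLayerLifting) : GenericPrimeDegenerateLifting := (cells_of_deg (Summit.Langlands.Langlands.Theorems.LieDefectBridge.deg_route_iff.1 h)).1

/-- WEAKER: DEG ⟹ XS. -/
theorem xs_of_deg (h : LieDefectSplit.DegenerateLayerLifting) : ExtendedAdequateLayerLifting := (cells_of_deg (Summit.Langlands.Langlands.Theorems.LieDefectBridge.deg_route_iff.1 h)).2.1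

/-- WEAKER: DEG ⟹ CRD. -/
theorem crd_of_deg (h : LieDefectSplit.DegenerateLayerLifting) : CoreReducibleDegenerateLifting := (cells_of_deg (Summit.Langlands.Langlands.Theorems.LieDefectBridge.deg_route_iff.1 h)).2.2.1

/-- WEAKER: DEG ⟹ CORE. -/
theorem core_of_deg (h : LieDefectSplit.DegenerateLayerLifting) : CoreIrreducibleInadequateLifting := (cells_of_deg (Summit.Langlands.Langlands.Theorems.LieDefectBridge.deg_route_iff.1 h)).2.2.2

end Cert


end Summit.Langlands.Langlands.Theorems.CoreAdequacy.ExtAdequacy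

/-! ## §6 The CHILD ROUTE one-liners VERBATIM (childroute.route.json) and their identity certificates -/

namespace Summit.Langlands.Langlands.Theorems.ExtAdequacyInline

open Filter
open Summit.Langlands.Langlands.Theses
open Summit.Langlands.Langlands.Theorems.CoreAdequacy

/-- Dedup-attached parent item OW (stmt-Langlands-28903), by name. -/
def OdlyzkoWorldAutomorphy : Prop := LieDefectSplit.OdlyzkoWorldAutomorphy
/-- Dedup-attached parent item RES (stmt-Langlands-28874), by name. -/
def TransOdlyzkoAutomorphy : Prop := LieDefectSplit.TransOdlyzkoAutomorphy
/-- Dedup-attached parent item W⁺ (stmt-Langlands-17415), by name. -/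
def SatakeAvatarExistence : Prop := LieDefectSplit.SatakeAvatarExistence
/-- Dedup-attached parent item CSD (stmt-Langlands-31695), by name. -/
def CliffordSolvableDescent : Prop := LieDefectSplit.CliffordSolvableDescent
/-- Dedup-attached host item RPO (stmt-Langlands-33908), by name. -/
def CyclotomicReducibleOrdinaryLifting : Prop := OdlyzkoWorldSplit.CyclotomicReducibleOrdinaryLifting
/-- Dedup-attached host item RNO₂ (stmt-Langlands-33909), by name. -/
def CyclotomicReducibleNonOrdinaryRankTwoLifting : Prop := OdlyzkoWorldSplit.CyclotomicReducibleNonOrdinaryRankTwoLifting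
/-- Dedup-attached host item RNO₃ (stmt-Langlands-33910), by name. -/
def CyclotomicReducibleNonOrdinaryHigherRankLifting : Prop := OdlyzkoWorldSplit.CyclotomicReducibleNonOrdinaryHigherRankLifting

/-- [item] XS `ExtendedAdequateLayerLifting` (crux 2; 1722 chars; childroute.route.json verbatim). -/
def ExtendedAdequateLayerLifting : Prop :=
  ∀ (K : Type) [Field K] [NumberField K] (n : ℕ) (hcpt : Literature.NumberTheory.Automorphic.isCompact_glFiniteIntegralLevel n K), 0 < n → Summit.Langlands.Langlands.Theorems.CoreAdequacy.LiftBelow n → ∀ (ℓ : ℕ) [Fact ℓ.Prime] (ι : PadicAlgCl ℓ ≃+* ℂ) (ρ : Literature.NumberTheory.GaloisRepresentations.FramedGaloisRep K (PadicAlgCl ℓ) n), ℓ < 2 * (n + 1) → Summit.Langlands.Langlands.Theorems.CoreAdequacy.CycIrr ρ → ¬ Summit.Langlands.Langlands.Theorems.CoreAdequacy.AdequateCyclotomicImage ρ → ¬ Summit.Langlands.Langlands.Theorems.CoreAdequacy.SolvablyAdequateImage ρ → ¬ Summit.Langlands.Langlands.Theorems.CoreAdequacy.LieDefect.SolvableDescentShadow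 ρ → ¬ Summit.Langlands.Langlands.Theorems.CoreAdequacy.LieDefect.SolvablyQuasiAdequateImage ρ → ℓ ≤ n → (∃ τ : Field.absoluteGaloisGroup (CyclotomicField ℓ K) →* Matrix.GeneralLinearGroup (Fin n) (Literature.NumberTheory.GaloisRepresentations.padicAlgClResidueField ℓ), (ρ.restrictField (CyclotomicField ℓ K)).IsReductionOf (RingHom.id (Literature.NumberTheory.GaloisRepresentations.padicAlgClResidueField ℓ)) τ ∧ Literature.NumberTheory.GaloisRepresentations.IsAbsIrreducible τ ∧ ∃ J : Subgroup (Matrix.GeneralLinearGroup (Fin n) (Literature.NumberTheory.GaloisRepresentations.padicAlgClResidueField ℓ)), Summit.Langlands.Langlands.Theorems.CoreAdequacy.LieDefect.AboveCore τ.range J ∧ J ≤ τ.range ∧ Literature.NumberTheory.GaloisRepresentations.IsAbsIrreducible J.subtype ∧ Literature.NumberTheory.GaloisRepresentations.Subgroup.IsExtendedAdequate J) → ¬ Summit.Langlands.Langlands.Theorems.BrightMate.SolvablyReducible ρ → ¬ Summit.Langlands.Langlands.Theorems.BrightMate.SolvablyMated ι ρ → Summit.Langlands.Langlands.Theorems.CoreAdequacy.LiftTail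 K n hcpt ℓ ι ρ

/-- [item] CORE `CoreIrreducibleInadequateLifting` (crux 3, declared residual; 2246 chars; verbatim). -/
def CoreIrreducibleInadequateLifting : Prop :=
  ∀ (K : Type) [Field K] [NumberField K] (n : ℕ) (hcpt : Literature.NumberTheory.Automorphic.isCompact_glFiniteIntegralLevel n K), 0 < n → Summit.Langlands.Langlands.Theorems.CoreAdequacy.LiftBelow n → ∀ (ℓ : ℕ) [Fact ℓ.Prime] (ι : PadicAlgCl ℓ ≃+* ℂ) (ρ : Literature.NumberTheory.GaloisRepresentations.FramedGaloisRep K (PadicAlgCl ℓ) n), ℓ < 2 * (n + 1) → Summit.Langlands.Langlands.Theorems.CoreAdequacy.CycIrr ρ → ¬ Summit.Langlands.Langlands.Theorems.CoreAdequacy.AdequateCyclotomicImage ρ → ¬ Summit.Langlands.Langlands.Theorems.CoreAdequacy.SolvablyAdequateImage ρ → ¬ Summit.Langlands.Langlands.Theorems.CoreAdequacy.LieDefect.SolvableDescentShadow ρ → ¬ Summit.Langlands.Langlands.Theorems.CoreAdequacy.LieDefect.SolvablyQuasiAdequateImage ρ → ℓ ≤ n → ¬ (∃ τ : Field.absoluteGaloisGroup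 (CyclotomicField ℓ K) →* Matrix.GeneralLinearGroup (Fin n) (Literature.NumberTheory.GaloisRepresentations.padicAlgClResidueField ℓ), (ρ.restrictField (CyclotomicField ℓ K)).IsReductionOf (RingHom.id (Literature.NumberTheory.GaloisRepresentations.padicAlgClResidueField ℓ)) τ ∧ Literature.NumberTheory.GaloisRepresentations.IsAbsIrreducible τ ∧ ∃ J : Subgroup (Matrix.GeneralLinearGroup (Fin n) (Literature.NumberTheory.GaloisRepresentations.padicAlgClResidueField ℓ)), Summit.Langlands.Langlands.Theorems.CoreAdequacy.LieDefect.AboveCore τ.range J ∧ J ≤ τ.range ∧ Literature.NumberTheory.GaloisRepresentations.IsAbsIrreducible J.subtype ∧ Literature.NumberTheory.GaloisRepresentations.Subgroup.IsExtendedAdequate J) → (∃ τ : Field.absoluteGaloisGroup (CyclotomicField ℓ K) →* Matrix.GeneralLinearGroup (Fin n) (Literature.NumberTheory.GaloisRepresentations.padicAlgClResidueField ℓ), (ρ.restrictField (CyclotomicField ℓ K)).IsReductionOf (RingHom.id (Literature.NumberTheory.GaloisRepresentations.padicAlgClResidueField ℓ)) τ ∧ Literature.NumberTheory.GaloisRepresentations.IsAbsIrreducible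 τ ∧ Literature.NumberTheory.GaloisRepresentations.IsAbsIrreducible (Summit.Langlands.Langlands.Theorems.CoreAdequacy.perfectCore τ.range).subtype) → ¬ Summit.Langlands.Langlands.Theorems.BrightMate.SolvablyReducible ρ → ¬ Summit.Langlands.Langlands.Theorems.BrightMate.SolvablyMated ι ρ → Summit.Langlands.Langlands.Theorems.CoreAdequacy.LiftTail K n hcpt ℓ ι ρ

/-- [item] HIGH `GenericPrimeDegenerateLifting` (support; 971 chars; verbatim). -/
def GenericPrimeDegenerateLifting : Prop :=
  ∀ (K : Type) [Field K] [NumberField K] (n : ℕ) (hcpt : Literature.NumberTheory.Automorphic.isCompact_glFiniteIntegralLevel n K), 0 < n → Summit.Langlands.Langlands.Theorems.CoreAdequacy.LiftBelow n → ∀ (ℓ : ℕ) [Fact ℓ.Prime] (ι : PadicAlgCl ℓ ≃+* ℂ) (ρ : Literature.NumberTheory.GaloisRepresentations.FramedGaloisRep K (PadicAlgCl ℓ) n), ℓ < 2 * (n + 1) → Summit.Langlands.Langlands.Theorems.CoreAdequacy.CycIrr ρ → ¬ Summit.Langlands.Langlands.Theorems.CoreAdequacy.AdequateCyclotomicImage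 ρ → ¬ Summit.Langlands.Langlands.Theorems.CoreAdequacy.SolvablyAdequateImage ρ → ¬ Summit.Langlands.Langlands.Theorems.CoreAdequacy.LieDefect.SolvableDescentShadow ρ → ¬ Summit.Langlands.Langlands.Theorems.CoreAdequacy.LieDefect.SolvablyQuasiAdequateImage ρ → n < ℓ → ¬ Summit.Langlands.Langlands.Theorems.BrightMate.SolvablyReducible ρ → ¬ Summit.Langlands.Langlands.Theorems.BrightMate.SolvablyMated ι ρ → Summit.Langlands.Langlands.Theorems.CoreAdequacy.LiftTail K n hcpt ℓ ι ρ

/-- [item] T_N `CoreReducibleTransport` (support; 2482 chars; verbatim — the short names are this route's dedup items). -/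
def CoreReducibleTransport : Prop :=
  OdlyzkoWorldAutomorphy → TransOdlyzkoAutomorphy → SatakeAvatarExistence → CliffordSolvableDescent → CyclotomicReducibleOrdinaryLifting → CyclotomicReducibleNonOrdinaryRankTwoLifting → CyclotomicReducibleNonOrdinaryHigherRankLifting → ∀ (K : Type) [Field K] [NumberField K] (n : ℕ) (hcpt : Literature.NumberTheory.Automorphic.isCompact_glFiniteIntegralLevel n K), 0 < n → Summit.Langlands.Langlands.Theorems.CoreAdequacy.LiftBelow n → ∀ (ℓ : ℕ) [Fact ℓ.Prime] (ι : PadicAlgCl ℓ ≃+* ℂ) (ρ : Literature.NumberTheory.GaloisRepresentations.FramedGaloisRep K (PadicAlgCl ℓ) n), ℓ < 2 * (n + 1) → Summit.Langlands.Langlands.Theorems.CoreAdequacy.CycIrr ρ → ¬ Summit.Langlands.Langlands.Theorems.CoreAdequacy.AdequateCyclotomicImage ρ → ¬ Summit.Langlands.Langlands.Theorems.CoreAdequacy.SolvablyAdequateImage ρ → ¬ Summit.Langlands.Langlands.Theorems.CoreAdequacy.LieDefect.SolvableDescentShadow ρ → ¬ Summit.Langlands.Langlands.Theorems.CoreAdequacy.LieDefect.SolvablyQuasiAdequateImage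 ρ → ℓ ≤ n → ¬ (∃ τ : Field.absoluteGaloisGroup (CyclotomicField ℓ K) →* Matrix.GeneralLinearGroup (Fin n) (Literature.NumberTheory.GaloisRepresentations.padicAlgClResidueField ℓ), (ρ.restrictField (CyclotomicField ℓ K)).IsReductionOf (RingHom.id (Literature.NumberTheory.GaloisRepresentations.padicAlgClResidueField ℓ)) τ ∧ Literature.NumberTheory.GaloisRepresentations.IsAbsIrreducible τ ∧ ∃ J : Subgroup (Matrix.GeneralLinearGroup (Fin n) (Literature.NumberTheory.GaloisRepresentations.padicAlgClResidueField ℓ)), Summit.Langlands.Langlands.Theorems.CoreAdequacy.LieDefect.AboveCore τ.range J ∧ J ≤ τ.range ∧ Literature.NumberTheory.GaloisRepresentations.IsAbsIrreducible J.subtype ∧ Literature.NumberTheory.GaloisRepresentations.Subgroup.IsExtendedAdequate J) → ¬ (∃ τ : Field.absoluteGaloisGroup (CyclotomicField ℓ K) →* Matrix.GeneralLinearGroup (Fin n) (Literature.NumberTheory.GaloisRepresentations.padicAlgClResidueField ℓ), (ρ.restrictField (CyclotomicField ℓ K)).IsReductionOf (RingHom.id (Literature.NumberTheory.GaloisRepresentations.padicAlgClResidueField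 ℓ)) τ ∧ Literature.NumberTheory.GaloisRepresentations.IsAbsIrreducible τ ∧ Literature.NumberTheory.GaloisRepresentations.IsAbsIrreducible (Summit.Langlands.Langlands.Theorems.CoreAdequacy.perfectCore τ.range).subtype) → ¬ Summit.Langlands.Langlands.Theorems.BrightMate.SolvablyReducible ρ → ¬ Summit.Langlands.Langlands.Theorems.BrightMate.SolvablyMated ι ρ → Summit.Langlands.Langlands.Theorems.CoreAdequacy.LiftTail K n hcpt ℓ ι ρ

/-- [item] FRAME″ `DegenerateLayerFrame` (support; verbatim). -/
def DegenerateLayerFrame : Prop :=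
  Summit.Langlands.Langlands.Theses.LieDefectSplit.DegenerateLayerLifting → _root_.Langlands

/-- [item] Assembly (verbatim). -/
def Assembly : Prop :=
  ExtendedAdequateLayerLifting → CoreIrreducibleInadequateLifting → GenericPrimeDegenerateLifting → OdlyzkoWorldAutomorphy → TransOdlyzkoAutomorphy → SatakeAvatarExistence → CliffordSolvableDescent → CyclotomicReducibleOrdinaryLifting → CyclotomicReducibleNonOrdinaryRankTwoLifting → CyclotomicReducibleNonOrdinaryHigherRankLifting → CoreReducibleTransport → DegenerateLayerFrame → _root_.Langlands

/-- The inline XS IS the structured cell. -/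
theorem xs_inline_iff : ExtendedAdequateLayerLifting ↔ ExtAdequacy.ExtendedAdequateLayerLifting := Iff.rfl
/-- The inline CORE IS the structured cell. -/
theorem core_inline_iff : CoreIrreducibleInadequateLifting ↔ ExtAdequacy.CoreIrreducibleInadequateLifting := Iff.rfl
/-- The inline HIGH IS the structured cell. -/
theorem high_inline_iff : GenericPrimeDegenerateLifting ↔ ExtAdequacy.GenericPrimeDegenerateLifting := Iff.rfl
/-- The inline T_N IS the structured support. -/
theorem transport_inline_iff : CoreReducibleTransport ↔ ExtAdequacy.CoreReducibleTransport := Iff.rfl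
/-- The inline FRAME″ IS the structured support. -/
theorem frame_inline_iff : DegenerateLayerFrame ↔ ExtAdequacy.DegenerateLayerFrame := Iff.rfl

/-- `closes_inline` — the child route's DECIDING THEOREM on the verbatim one-liners (12 binders, all used; = childroute.glue.lean up to unfolding). -/
theorem closes_inline (hH : GenericPrimeDegenerateLifting) (hX : ExtendedAdequateLayerLifting) (hC : CoreIrreducibleInadequateLifting)
    (hTn : CoreReducibleTransport) (hOW : OdlyzkoWorldAutomorphy) (hRES : TransOdlyzkoAutomorphy) (hW : SatakeAvatarExistence)
    (hDown : CliffordSolvableDescent) (hPO : CyclotomicReducibleOrdinaryLifting) (hR2 : CyclotomicReducibleNonOrdinaryRankTwoLifting)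
    (hR3 : CyclotomicReducibleNonOrdinaryHigherRankLifting) (hF : DegenerateLayerFrame) : _root_.Langlands :=
  ExtAdequacy.closes_framed hH hX hC hTn hOW hRES hW hDown hPO hR2 hR3 hF

/-- The Assembly item HOLDS (it is the curried `closes_inline`). -/
theorem assembly_holds : Assembly :=
  fun hX hC hH hOW hRES hW hDown hPO hR2 hR3 hTn hF => closes_inline hH hX hC hTn hOW hRES hW hDown hPO hR2 hR3 hF


/-! ## §7 Bridges to the BORN route decls (route-Langlands-ExtendedAdequacySplit rev 0): ledger text ≡ node text, by `Iff.rfl` -/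

/-- XS: the route decl IS the node one-liner. -/
theorem xs_route_iff : Summit.Langlands.Langlands.Theses.ExtendedAdequacySplit.ExtendedAdequateLayerLifting ↔ ExtendedAdequateLayerLifting := Iff.rfl
/-- CORE (declared residual): the route decl IS the node one-liner. -/
theorem core_route_iff : Summit.Langlands.Langlands.Theses.ExtendedAdequacySplit.CoreIrreducibleInadequateLifting ↔ CoreIrreducibleInadequateLifting := Iff.rfl
/-- HIGH: the route decl IS the node one-liner. -/
theorem high_route_iff : Summit.Langlands.Langlands.Theses.ExtendedAdequacySplit.GenericPrimeDegenerateLifting ↔ GenericPrimeDegenerateLifting := Iff.rfl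
/-- T_N: the route decl IS the node one-liner. -/
theorem transport_route_iff : Summit.Langlands.Langlands.Theses.ExtendedAdequacySplit.CoreReducibleTransport ↔ CoreReducibleTransport := Iff.rfl
/-- FRAME″: the route decl IS the node one-liner. -/
theorem frame_route_iff : Summit.Langlands.Langlands.Theses.ExtendedAdequacySplit.DegenerateLayerFrame ↔ DegenerateLayerFrame := Iff.rfl

end Summit.Langlands.Langlands.Theorems.ExtAdequacyInline
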